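import Summits.HodgeConjecture.HodgeConjecture.Theorems.F0P6aEExportsReadings
import HarnessLib

/-!
# `F0P6aEExportsFrames` — ★ RE-HOME of `Lines/F0_P6a_EExports.lean`, PART 2 of 3 (size-lint split; cut at a declaration boundary).

## Import provenance
- `Theorems.F0P6aEExportsReadings` = ★ previous part of the same `Lines` workfile `F0_P6a_EExports` (size-lint split ×3); `HarnessLib`.

See PART 1 `Theorems/F0P6aEExportsReadings.lean` for the full re-home header and the original module docstring (verbatim there). Namespaces and sections KEPT
(re-opened below exactly as they stand at the cut, with their `open`∕`variable` lines replayed); code bytes = the workfile՚s, docstrings included; options preamble repeated from PART 1.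
HC_CM is proved only modulo the 7 printed citations (2 remaining: hLiu418 = stmt-HodgeConjecture-24832, h413 = stmt-HodgeConjecture-24833) until rung 0 closes; a re-home is count-neutral. -/

set_option autoImplicit false

noncomputable section

namespace Summit.HodgeConjecture.HodgeConjecture.Cruxes.HLiu418.F0P6aEExports
set_option linter.dupNamespace false  -- `Summit.HodgeConjecture.HodgeConjecture.…` BY DESIGN (D-0017)
open CategoryTheory CategoryTheory.Limits NumberField IsDedekindDomain MulAction AlgebraicGeometry
open scoped Matrix Polynomial Pointwise
open Literature.NumberTheory.GaloisRepresentations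
open Literature.NumberTheory.Automorphic Literature.NumberTheory.Automorphic.UnitaryGroup
open Literature.AlgebraicGeometry.ShimuraVarieties Literature.AlgebraicGeometry.ShimuraVarieties.UnitaryCanonicalModel
open Literature.NumberTheory.Automorphic.Liu2021.AppendixC
open Literature.AlgebraicGeometry.Motives (AlgPoints ComplexPoints SchemeOver thickeningLift specOver)
open Literature.AlgebraicGeometry.Motives.AbelianVariety (bcSpec)
open Literature.AlgebraicGeometry.AbelianSchemes (PolarizedAbelianSchemeWithLevel AbelianSchemeOver)
open Literature.AlgebraicGeometry.ModuliOfAbelianVarieties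
open Summit.HodgeConjecture.HodgeConjecture.Cruxes.HLiu418.F0P6aPELWitnessE
open Summit.HodgeConjecture.HodgeConjecture.Cruxes.HLiu418.F0P6aStubE6 (RingActionReading RosatiOver KottwitzOver ReadsC
  readsC_of_galois_of_reading exists_reads_of_readsC exists_ringActionReading_of_reads rosatiOver_of_ringActionReading kottwitzOver_of_reading)
open Summit.HodgeConjecture.HodgeConjecture.Cruxes.HLiu418.F0P6aSigmaGAL (sigmaGAL_of_stub)
open Summit.HodgeConjecture.HodgeConjecture.Cruxes.HLiu418.F0P6aStubKOTT (KottAdaptedAt UnmixedAt)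
open Summit.HodgeConjecture.HodgeConjecture.Cruxes.HLiu418.F0P6aPELInputs (ESepAt)
open Summit.HodgeConjecture.HodgeConjecture.Cruxes.HLiu418.F0P6aEReadings (EHeckeAt ETwistKerAt HeckeRoofsE CoverKerE CoverE)
open Summit.HodgeConjecture.HodgeConjecture.Theorems.F0P6aReadsCReadingOfJunction (readsCReading_of_junction)
open Summit.HodgeConjecture.HodgeConjecture.Cruxes.HLiu418.F0P6aChartFramePin (IsChartOfFrame)
open Literature.AlgebraicGeometry.Motives (CMType)
open Literature.AlgebraicGeometry.ShimuraVarieties.UnitaryCanonicalModel.Aux (ratBasis torusFinAdelic)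
open Literature.AlgebraicGeometry.ShimuraVarieties.UnitaryCurve Literature.AlgebraicGeometry.ShimuraVarieties.UnitaryCurve.AuxV
open Literature.NumberTheory.ComplexMultiplication.CMTypeOps (flip bar)


/-- **(T-E) FOR `witnessOf`, FROM THE SOCKET** — `ETwistKerAt S Kc w e (witnessOf C ε ρ …) p f` IS the conclusion of `RecordESheetReading` at the canonical tuple (`rfl` on the
projections), so `stub_ESHEET` applies on the nose. [cite: Shimura1998, §13.1 Thm. 1; §18.6] [cite: RapoportSmithlingZhang2020Diagonal, §3.2 p. 11, §4.3 p. 20] -/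
theorem eTwistKerAt_witnessOf (F : Type) [Field F] [NumberField F] [IsCMField F] [IsGalois ℚ F] (ι₁ : F →+* ℂ)
    (Jstar : Matrix (Fin 2) (Fin 2) F) (hJ : (Jstar.map (IsCMField.complexConj F))ᵀ = Jstar) (hJu : IsUnit Jstar)
    (K₀ : C5.OpenCompactSubgroup (GSAdele F Jstar)) (S : RecordSystemGS F Jstar ι₁ K₀) (hU7ₛ : S.HeckeTranslateDefinedOver) (Kc : C5.SmallLevel K₀)
    (Fi : Type) [Field Fi] [NumberField Fi] [Algebra F Fi] [IsGalois F Fi] (τE : Fi →+* ℂ) (hτE : τE.comp (algebraMap F Fi) = ι₁)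
    (Φ : Set (F →+* ℂ)) (hΦ : IsCMTypeThrough ι₁ Φ) (C : AuxChartGS F ι₁ Jstar K₀ S Kc Fi τE Φ)
    (ξ : F) (k : ℕ) (Fr : SymplecticFrameV F (RingHom.id F) Jstar ((k : ℚ) • ξ) C.g C.δ) (hpin : IsChartOfFrame hΦ C ξ k Fr)
    (ε : (Literature.AlgebraicGeometry.Motives.baseChange F Fi).obj (S.M.obj Kc) ⟶
        (Literature.AlgebraicGeometry.Motives.baseChange ℚ Fi).obj C.𝓜.M)
    (hε : letI : Algebra Fi ℂ := τE.toAlgebra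
      ∀ (P : ComplexPoints ((Literature.AlgebraicGeometry.Motives.baseChange F Fi).obj (S.M.obj Kc)))
        (Pflat : letI : Algebra F ℂ := ι₁.toAlgebra; ComplexPoints (S.M.obj Kc)),
        Pflat.left = P.left ≫ pullback.fst (S.M.obj Kc).hom (bcSpec F Fi) →
        (AlgPoints.map ε P).left ≫ pullback.fst C.𝓜.M.hom (bcSpec ℚ Fi) =
          (letI : Algebra F ℂ := ι₁.toAlgebra; (C.f (S.pts Kc Pflat)).left))
    (ρ : AbelianSchemeOver.RingAction (𝓞 F) (C.𝓜.univ.baseChange (ε.left ≫ pullback.fst C.𝓜.M.hom (bcSpec ℚ Fi))).A)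
    (hρ : RingActionReading C ε ρ) (hRos : RosatiOver C ε ρ) (hKot : KottwitzOver C ε ρ)
    (hsep : letI : Algebra Fi ℂ := τE.toAlgebra
       Function.Injective
        (AlgPoints.map ε : ComplexPoints ((Literature.AlgebraicGeometry.Motives.baseChange F Fi).obj (S.M.obj Kc)) →
          ComplexPoints ((Literature.AlgebraicGeometry.Motives.baseChange ℚ Fi).obj C.𝓜.M)))
    (w : HeightOneSpectrum (𝓞 F)) (hw : (IsCMField.complexConj F) • w ≠ w)
    (hhyp : UnitaryGroup.IsHyperspecialAt ↥(maximalRealSubfield F) F (IsCMField.complexConj F) 2 Jstar Kc.1.1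
      (w.under (𝓞 ↥(maximalRealSubfield F))))
    (hunit : (UnitaryGroup.isUnit_placeForm Jstar hJu w).unit ∈ glInt 2 (w.adicCompletion F))
    (pChar fDeg : ℕ) (hp : Nat.Prime pChar) (hpw : (pChar : 𝓞 F) ∈ w.asIdeal)
    (hcard : Nat.card (𝓞 F ⧸ ((IsCMField.complexConj F) • w).asIdeal) = pChar ^ fDeg) (hN : ¬ pChar ∣ C.N)
    (had : KottAdaptedAt ι₁ w Φ) (hun : UnmixedAt ι₁ w Φ) (e : Fi →ₐ[F] AlgebraicClosure (w.adicCompletion F)) :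
    ETwistKerAt S Kc w e (witnessOf C ε ρ hRos hKot hsep) pChar fDeg :=
  stub_ESHEET F ι₁ Jstar hJ hJu K₀ S hU7ₛ Kc Fi τE hτE Φ hΦ C ξ k Fr hpin ε hε ρ hρ w hw hhyp hunit pChar fDeg hp hpw hcard hN had hun e

/-! ### §5 (cand v3) The single-frame head `eLaws_of_line` of cand v1∕v2 is WITHDRAWN: it drew its chart from the E-line՚s `stub_E123` (`Nonempty (AuxChartGS …)`,
no frame pin), which cannot feed the frame-pinned sockets; nobody consumes it (GEN calls `eLaws_of_frames`, §6; the single-frame case is `ιdx := PUnit`). -/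

/-! ### §6 THE MULTI-FRAME FORM (GEN A-p18 (g32) 05:15:48Z: several CM types at ONE common small level) — socket «COMMON-LEVEL CHARTS» + head `eLaws_of_frames` -/

/-- **LETTER `RecordEFrames` — CHARTS FOR FINITELY MANY FRAMES AT ONE COMMON SMALL LEVEL, NORMAL IN `K`** (the multi-frame twin of the E-line՚s PAID `stub_E123`; GEN
A-p18 (g32) 05:15:48Z integration constraint, E-pen answer 05:24:33Z (3)): in every letter context with a signature datum, for a FINITE family of CM types `Φf i ∋ ι₁`,
there is ONE small level `Kc'' ≤ K`, normal in `K` (`C5.HeckeLE u Kc'' Kc''` for `u ∈ K`), at which EVERY frame `i` has — over every slice field containing a finite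
Galois `Fᵢ₀(i)` with `τ₀(i) ∣ ι₁` — an auxiliary Siegel chart `AuxChartGS … Kc'' Fi τE (Φf i)` (ED. 5 fields, incl. `f_injective` and `junction`).  WHY TRUE ∕ ROAD
(E1 organ «COMMON LATTICE», M, + `stub_E123`՚s body per frame): `b⁻¹K_δ(N) ∩ K` depends only on the `K`-stable LATTICE `Λ̂` spanned by the frame (`u ∈ b⁻¹K_δ(N) ↔
(u − 1)Λ̂ ⊆ NΛ̂`), not on the form `ψ_ξ`; cut the frames of all `ξᵢ` (★ `exists_xi_of_sigDatum (Φf i)′`) as elementary-divisor bases of ONE `K`-stable lattice (★ 7b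
`exists_symplecticFrameV_integralAction` run for the family), so `K ⊓ bᵢ⁻¹K_{δᵢ}(N) = K ⊓ L(N)` for all `i`; take `N := 3(k+1)!` with `k ≥ maxᵢ k₀ᵢ` (Deligne 1.15 per
frame, ★ p847628) and `Kc'' := K ⊓ L(N)` (★ `isOpen∕isCompact_inf_comap_principalLevelSubgroup`, normal by ★ `principalLevelSubgroup_normal_in_one`); then frame `i`՚s
ED.-5 construction runs VERBATIM at `Kc''` (its defining equality `Kc''.1.1 = K.1.1 ⊓ bᵢ⁻¹K_{δᵢ}(N)` holds for every `i`).  WHY IT MIGHT FAIL: only if 7b cannot be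
run on a prescribed lattice (its statement chooses the lattice inside; the family version re-opens the proof — by copy).  A uniform depth `k₀` BEFORE a sublevel
binder `∀ Kc' ≤ K` would be FALSE (`Kc' ↓ 1` kills injectivity); no sublevel binder appears here.  NOT asserted.
(print: Deligne1971TravauxShimura, Prop. 1.15 p. 132) (print: RapoportSmithlingZhang2020Diagonal, Remark 3.1 p. 9, §3.2 pp. 11–14) (print: Milne2005ShimuraVarieties, Thm. 6.11 p. 74) -/
def RecordEFrames : Prop :=
  ∀ (F : Type) [Field F] [NumberField F] [IsCMField F] [IsGalois ℚ F] (ι₁ : F →+* ℂ)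
    (Jstar : Matrix (Fin 2) (Fin 2) F) (_hJ : (Jstar.map (IsCMField.complexConj F))ᵀ = Jstar) (_hJu : IsUnit Jstar)
    (K₀ : C5.OpenCompactSubgroup (GSAdele F Jstar)) (S : RecordSystemGS F Jstar ι₁ K₀) (K : C5.SmallLevel K₀)
    (ιdx : Type) [Finite ιdx] (Φf : ιdx → Set (F →+* ℂ)) (hΦf : ∀ i, IsCMTypeThrough ι₁ (Φf i)) (_hsig : SigDatum F ι₁ Jstar),
    ∃ (Kc'' : C5.SmallLevel K₀), Kc'' ≤ K ∧ (∀ u ∈ K.1.1, C5.HeckeLE u Kc'' Kc'') ∧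
      ∀ i : ιdx, ∃ (Fi₀ : Type) (_ : Field Fi₀) (_ : NumberField Fi₀) (_ : Algebra F Fi₀) (_ : IsGalois F Fi₀) (τ₀ : Fi₀ →+* ℂ),
        τ₀.comp (algebraMap F Fi₀) = ι₁ ∧
        ∀ (Fi : Type) [Field Fi] [NumberField Fi] [Algebra F Fi] [IsGalois F Fi] (τE : Fi →+* ℂ) (j : Fi₀ →ₐ[F] Fi),
          τE.comp (j : Fi₀ →+* Fi) = τ₀ →
          ∃ (C : AuxChartGS F ι₁ Jstar K₀ S Kc'' Fi τE (Φf i)) (ξ : F) (k : ℕ)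
            (Fr : SymplecticFrameV F (RingHom.id F) Jstar ((k : ℚ) • ξ) C.g C.δ), IsChartOfFrame (hΦf i) C ξ k Fr

/-! #### §6a (ED. 1 cand v2) THE PAYMENT OF `stub_EFRAMES` — LA4-p02 (g2) BY COPY: `stub_E123` of a GIVEN frame + the common-lattice ∕ common-level assembly -/

section StubEFramesPaid

-- (ED. 1 cand v2) LA4-p02 (g2) payment BY COPY (HOME `F0/P6/L4/LA4-p02/g2/StubEFRAMES.paid.byimport.v1.LA4-p02g2.lean` 131bd80cece08d0f §1–§2, author credit LA4-p02):
-- the E-line opens his section assumed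
open Matrix
open scoped ComplexOrder
open Literature.AlgebraicGeometry.HodgeTheory (IsQuasiProjectiveOver)

open scoped TensorProduct
open Literature.AlgebraicGeometry.Motives (CMType)
open Literature.AlgebraicGeometry.ModuliOfAbelianVarieties.SiegelModuli (C0 jOfSiegel jOfSiegel_mem_C0)
open Literature.AlgebraicGeometry.ShimuraVarieties.UnitaryCanonicalModel.Aux (ratBasis torusFinAdelic)
open Literature.AlgebraicGeometry.ShimuraVarieties.UnitaryCurve Literature.AlgebraicGeometry.ShimuraVarieties.UnitaryCurve.AuxV
open Literature.NumberTheory.ComplexMultiplication.CMTypeOps (flip bar mem_flip_bar_self)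
open Literature.NumberTheory.NumberFields (exists_isGalois_envelope)
open Summit.HodgeConjecture.HodgeConjecture.Theorems.F0P6aSpecialPairRecipOfChart (exists_sliceField_f_recip)
open Summit.HodgeConjecture.HodgeConjecture.Theorems.F0P6aSpecialPairRecipDatumOfChart (exists_sliceField_f_recip_cmDatum_pinned)
open Summit.HodgeConjecture.HodgeConjecture.Theorems.HCCMUnconditionalSiegelDebtClosers (siegelModuli_complexUniformisation_holds)
open Summit.HodgeConjecture.HodgeConjecture.Theorems.HCCMUnconditionalSiegelFineModuliDebtCloser (lan2013_siegelFineModuliScheme_holds)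

/-! ### §1 The chart of a GIVEN frame at every deep saturated level -/

/-- **`stub_E123` OF A GIVEN FRAME** (ED. 5 :196 body BY COPY from `have hbcont` on): in a letter context with the signature datum OPENED (`t`, `T`, `hpos`),
for a CM type `Φ ∋ ι₁`, a skew scalar `ξ` whose rescaling `k•ξ` is adapted to `Φ′ = flip ι₁ (bar Φ)` after division by `t` (`hξ'`), and an E1 integral symplectic
frame `Fr` of `k•ψ_ξ` of type `δ` (`g > 0`, `δ` a polarisation type) with integral `𝓞_F`-reading `ρ` (the conjuncts of ★ 7b ∕ ★ 7b-FAMILY VERBATIM;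
the containment `Kc × ⊥ ≤ K̃_{Fr}(1)` is NOT needed for the chart — only for the normality of the saturated level, §2): there is a depth `k₀` such that for every `kk ≥ k₀` and every small level `Kc″` with `Kc″ = Kc ⊓ b_{Fr}⁻¹K_δ(3(kk+1)!)` (`b_{Fr} = ũ_{Fr} ∘ inl`) there is a
slice field `Fᵢ₀ ∕ F` (finite Galois, `τ₀ ∣ ι₁`) with, over every slice field `Fᵢ ⊇ Fᵢ₀`, an `AuxChartGS … Kc″ Fi τE Φ`.
[cite: Deligne1979ShimuraVarieties, 2.3.10] [cite: RapoportSmithlingZhang2020Diagonal, Remark 3.1 p. 9, §3.2 and Lemma 3.4–Prop. 3.7 pp. 11–14]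
[cite: Deligne1971TravauxShimura, Prop. 1.15 p. 132] [cite: Milne2005ShimuraVarieties, Thm. 6.11 p. 74] -/
theorem chart_of_frame (F : Type) [Field F] [NumberField F] [IsCMField F] [IsGalois ℚ F] (ι₁ : F →+* ℂ)
    (Jstar : Matrix (Fin 2) (Fin 2) F) (hJ : (Jstar.map (IsCMField.complexConj F))ᵀ = Jstar)
    (K₀ : C5.OpenCompactSubgroup (GSAdele F Jstar)) (S : RecordSystemGS F Jstar ι₁ K₀) (Kc : C5.SmallLevel K₀)
    (Φ : Set (F →+* ℂ)) (hΦ : IsCMTypeThrough ι₁ Φ)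
    -- the opened signature datum
    (t : F) (hτt : 0 < (ι₁ t).re) (hτt' : (ι₁ t).im = 0) (T : GL (Fin 2) ℂ)
    (hT : ((T : GL (Fin 2) ℂ) : Matrix (Fin 2) (Fin 2) ℂ)ᴴ * (t • Jstar).map ι₁ * (T : Matrix (Fin 2) (Fin 2) ℂ) = signatureMatrix 1)
    (hpos : ∀ σ : F →+* ℂ, NumberField.InfinitePlace.mk σ ≠ NumberField.InfinitePlace.mk ι₁ → ((t • Jstar).map σ).PosDef)
    -- the given E1 frame for the skew scalar `k•ξ` (★ 7b ∕ ★ 7b-FAMILY conjuncts) and the adapted sign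
    (ξ : F) {k g : ℕ} {δ : Fin g → ℕ} (Fr : SymplecticFrameV F (RingHom.id F) Jstar ((k : ℚ) • ξ) g δ)
    (ρ : 𝓞 F →+* Matrix (Fin g ⊕ Fin g) (Fin g ⊕ Fin g) ℤ) (hg : 0 < g) (hδ : IsPolarizationType δ)
    (hρ : ∀ b : 𝓞 F, (ρ b).map (Int.cast : ℤ → ℚ) =
      framePV Fr * resMatrix (m := Fin 2) (ratBasis F) (((b : 𝓞 F) : F) • (1 : Matrix (Fin 2) (Fin 2) F)) * frameQV Fr)
    (hξ' : ∀ ρ' : (flip ι₁ (bar (⟨Φ, hΦ.2⟩ : CMType F))).1, (ρ'.1 (((k : ℚ) • ξ) * t⁻¹)).im < 0) :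
    ∃ k₀ : ℕ, ∀ kk : ℕ, k₀ ≤ kk → ∀ (Kc'' : C5.SmallLevel K₀),
      Kc''.1.1 = Kc.1.1 ⊓ (principalLevelSubgroup δ (3 * (kk + 1).factorial)).comap
        ((auxToGspFinV Fr).comp (MonoidHom.inl _ ↥(torusFinAdelic F))) →
    ∃ (Fi₀ : Type) (_ : Field Fi₀) (_ : NumberField Fi₀) (_ : Algebra F Fi₀) (_ : IsGalois F Fi₀) (τ₀ : Fi₀ →+* ℂ),
      τ₀.comp (algebraMap F Fi₀) = ι₁ ∧
      ∀ (Fi : Type) [Field Fi] [NumberField Fi] [Algebra F Fi] [IsGalois F Fi] (τE : Fi →+* ℂ) (j : Fi₀ →ₐ[F] Fi),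
        τE.comp (j : Fi₀ →+* Fi) = τ₀ →
        ∃ (C : AuxChartGS F ι₁ Jstar K₀ S Kc'' Fi τE Φ) (Fr' : SymplecticFrameV F (RingHom.id F) Jstar ((k : ℚ) • ξ) C.g C.δ),
          IsChartOfFrame hΦ C ξ k Fr' := by
  classical
  -- §0 the E2 CM type `Φ' = flip ι₁ (bar Φ)`
  set Φ' : CMType F := flip ι₁ (bar (⟨Φ, hΦ.2⟩ : CMType F)) with hΦ'
  have hΦ'm : ι₁ ∈ Φ'.1 := mem_flip_bar_self (⟨Φ, hΦ.2⟩ : CMType F) hΦ.1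
  have hbcont : Continuous ((auxToGspFinV Fr).comp (MonoidHom.inl _ ↥(torusFinAdelic F))) :=
    (continuous_auxToGspFinV Fr).comp (continuous_id.prodMk continuous_const)
  -- §2 the neat level `K₃ := Kc ⊓ b⁻¹K_δ(3)` (★ FILE 6 §2) and DELIGNE 1.15 AT PRINCIPAL LEVEL along the tower `Kc ⊓ b⁻¹K_δ(3(k+1)!)` (★ A-p01 p847628)
  have hK'o := isOpen_inf_comap_inl_auxLevelV Fr (N := 3) (by norm_num) Kc.1.1 Kc.1.2.1
  have hK'c := isCompact_inf_comap_inl_auxLevelV Fr (N := 3) (by norm_num) Kc.1.1 Kc.1.2.2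
  obtain ⟨K₃, hK₃⟩ : ∃ K₃ : C5.SmallLevel K₀, K₃.1.1 = Kc.1.1 ⊓ (auxLevelV Fr 3).comap (MonoidHom.inl _ ↥(torusFinAdelic F)) :=
    ⟨⟨⟨Kc.1.1 ⊓ (auxLevelV Fr 3).comap (MonoidHom.inl _ ↥(torusFinAdelic F)), hK'o, hK'c⟩,
      le_trans (inf_le_left : Kc.1.1 ⊓ (auxLevelV Fr 3).comap (MonoidHom.inl _ ↥(torusFinAdelic F)) ≤ Kc.1.1) Kc.2⟩, rfl⟩
  have hle₃ : K₃.1.1 ≤ (principalLevelSubgroup δ 3).comap ((auxToGspFinV Fr).comp (MonoidHom.inl _ _)) := by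
    rw [hK₃]; exact (inf_comap_inl_auxLevelV_le Fr 3 Kc.1.1).2
  obtain ⟨k₀, hk₀⟩ := exists_forall_le_siegelShadow_separates S (auxComplexStructureV Fr ι₁ Φ')
    (auxComplexStructureV_mem_C0pm_of_sigDatum Fr Φ' hΦ'm hJ hτt hτt' hξ' T hT hpos)
    ((auxToGspFinV Fr).comp (MonoidHom.inl _ _)) ((auxToGspRatV Fr).comp (MonoidHom.inl _ _))
    lan2013_siegelFineModuliScheme_holds siegelModuli_complexUniformisation_holds hg hδ
    (neg_auxComplexStructureV_mem_C0_of_sigDatum Fr Φ' hΦ'm hJ hτt hτt' hξ' T hT hpos)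
    (fun c hc v _ => auxComplexStructureV_smul Fr ι₁ Φ' v hc) (hb_auxToGspFinV_inl Fr)
    (auxComplexStructureV_hJrat Fr ι₁ Φ' (negCone (Jstar.map ι₁))) (auxComplexStructureV_hJinj Fr ι₁ Φ' (isExtAdapted_id_of_mem Φ' hΦ'm))
    (fun γ x h => hbrat_auxToGspFinV Fr γ x h) hbcont (fun γ _ hC => periodChartV F Fr Φ' ι₁ hδ.1 γ hC) (le_refl 3) K₃ hle₃
  refine ⟨k₀, fun kk hkk Kc'' hKc'' => ?_⟩
  -- the level `N = 3(kk+1)! ≥ 3` and the saturated source level `Kc'' = Kc ⊓ b⁻¹K_δ(N) = K₃ ⊓ b⁻¹K_δ(N)`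
  have hN : 3 ≤ 3 * (kk + 1).factorial := Nat.le_mul_of_pos_right 3 (Nat.factorial_pos _)
  have hle : Kc''.1.1 ≤ (principalLevelSubgroup δ (3 * (kk + 1).factorial)).comap ((auxToGspFinV Fr).comp (MonoidHom.inl _ _)) := by
    rw [hKc'']; exact inf_le_right
  have hK₃le : K₃.1.1 ⊓ (principalLevelSubgroup δ (3 * (kk + 1).factorial)).comap ((auxToGspFinV Fr).comp (MonoidHom.inl _ _)) ≤ Kc''.1.1 := by
    rw [hKc'', hK₃]
    exact fun x hx => ⟨hx.1.1, hx.2⟩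
  -- separation of `Sh_{Kc''}` by the level-`N` Siegel shadow (Deligne 1.15, conjunct (ii) of ★ p847628 moved up to `Kc''`)
  have hsep : ∀ (v v' : Fin 2 → ℂ) (hv : v ∈ negCone (Jstar.map ι₁)) (hv' : v' ∈ negCone (Jstar.map ι₁)) (a a' : GSAdele F Jstar),
      SiegelShimuraSet.mk δ (principalLevelSubgroup δ (3 * (kk + 1).factorial))
          ⟨auxComplexStructureV Fr ι₁ Φ' v, auxComplexStructureV_mem_C0pm_of_sigDatum Fr Φ' hΦ'm hJ hτt hτt' hξ' T hT hpos v hv⟩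
          (((auxToGspFinV Fr).comp (MonoidHom.inl _ _)) a) =
        SiegelShimuraSet.mk δ (principalLevelSubgroup δ (3 * (kk + 1).factorial))
          ⟨auxComplexStructureV Fr ι₁ Φ' v', auxComplexStructureV_mem_C0pm_of_sigDatum Fr Φ' hΦ'm hJ hτt hτt' hξ' T hT hpos v' hv'⟩
          (((auxToGspFinV Fr).comp (MonoidHom.inl _ _)) a') →
      ShimuraSetGS.mk F Jstar ι₁ Kc''.1.1 v hv a = ShimuraSetGS.mk F Jstar ι₁ Kc''.1.1 v' hv' a' :=
    fun v v' hv hv' a a' h => ShimuraSetGS.mk_eq_mk_of_le F Jstar ι₁ hK₃le ((hk₀ kk hkk).1 v v' hv hv' a a' h)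
  -- §3 the Siegel target (F) and the uniformisation fact (U), both PROVED in the cell
  obtain ⟨𝓜, hsmooth, hqp, -⟩ := lan2013_siegelFineModuliScheme_holds g (3 * (kk + 1).factorial) δ hg hδ hN
  -- §4 the chart with movers, carrier classification and (J) junction at `J_{Φ'}`, positivity from the signature datum
  obtain ⟨Sc, ιc, unif, f, piece, Z, u, rep, pts, q, hcol, hirr, hcont, hopen, hsurj, hiff, hhol, hrep, hZd, hZm, hfmk, hptsf,
      hmkrep, hval, hadm, hQ, hD3, hJunc⟩ :=
    exists_siegelChartGS_auxComplexStructureV_mover_classified_junction_of_sigDatum siegelModuli_complexUniformisation_holds hg hδ hN 𝓜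
      Φ' hΦ'm Fr hJ hτt hτt' hξ' T hT hpos Kc''.1.1 hle
  -- (P+) the point map is injective (★ `injective_of_shadow_formula` over `f_pts`)
  have hfinj : Function.Injective f :=
    injective_of_shadow_formula (auxComplexStructureV Fr ι₁ Φ') (auxComplexStructureV_mem_C0pm_of_sigDatum Fr Φ' hΦ'm hJ hτt hτt' hξ' T hT hpos)
      ((auxToGspFinV Fr).comp (MonoidHom.inl _ _)) Kc''.1.1 hsep f
      (fun y => pts (AlgPoints.baseChangeEquiv (algebraMap ℚ ℂ) 𝓜.M y)) hptsf
  -- §5 the (M) block: the conjugated lattice reading (★ FILE 9)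
  obtain ⟨Mρ, hR, hNρ, -, -, hfr⟩ := exists_chartActionReading_frame F Fr Φ' ι₁ hδ.1 ρ hρ rep (fun c => (hrep c).2.2.1) piece Z q hZm hQ
  -- §6 reciprocity (E3R glue) and the Galois envelope of its slice field
  obtain ⟨E₀, hfd, hι₁E₀, hrec⟩ := exists_sliceField_f_recip_cmDatum_pinned hg hδ hN 𝓜 ιc unif (fun c => (hrep c).1) (fun c => (hrep c).2.1)
    (fun c => (hrep c).2.2.2.1) hD3 pts hval ι₁ Jstar hJ Φ' hΦ'm Fr
    (auxComplexStructureV_mem_C0pm_of_sigDatum Fr Φ' hΦ'm hJ hτt hτt' hξ' T hT hpos) ρ hρ Kc''.1.1 f hptsf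
  obtain ⟨Fi₀, hF₀, hN₀, hA₀, hG₀, τ₀, hτ₀, hcov₀⟩ := exists_isGalois_envelope ι₁ E₀ hfd hι₁E₀
  refine ⟨Fi₀, hF₀, hN₀, hA₀, hG₀, τ₀, hτ₀, fun Fi _ _ _ _ τE jF hj => ?_⟩
  have hcov : ∀ x : ℂ, x ∈ E₀ → ∃ y : Fi, τE y = x := fun x hx => by
    obtain ⟨y₀, rfl⟩ := hcov₀ x hx
    exact ⟨jF y₀, by rw [← hj]; rfl⟩
  -- §7 assemble the chart
  refine ⟨{
      g := g
      N := 3 * (kk + 1).factorial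
      δ := δ
      hg := hg
      g_eq := Fr.eq_finrank_of_two
      hδ := hδ
      hN := hN
      𝓜 := 𝓜
      smooth_M := hsmooth
      quasiProjective_M := hqp
      J := auxComplexStructureV Fr ι₁ Φ'
      hJ := auxComplexStructureV_mem_C0pm_of_sigDatum Fr Φ' hΦ'm hJ hτt hτt' hξ' T hT hpos
      hJneg := neg_auxComplexStructureV_mem_C0_of_sigDatum Fr Φ' hΦ'm hJ hτt hτt' hξ' T hT hpos
      hJsmul := fun c hc v _ => auxComplexStructureV_smul Fr ι₁ Φ' v hc
      b := (auxToGspFinV Fr).comp (MonoidHom.inl _ _)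
      bq := (auxToGspRatV Fr).comp (MonoidHom.inl _ _)
      hb := hb_auxToGspFinV_inl Fr
      hJrat := auxComplexStructureV_hJrat Fr ι₁ Φ' (negCone (Jstar.map ι₁))
      hJinj := auxComplexStructureV_hJinj Fr ι₁ Φ' (isExtAdapted_id_of_mem Φ' hΦ'm)
      hbrat := fun γ x h => hbrat_auxToGspFinV Fr γ x h
      hbcont := (continuous_auxToGspFinV Fr).comp (continuous_id.prodMk continuous_const)
      hle := hle
      hZ := fun γ _ hC => periodChartV F Fr Φ' ι₁ hδ.1 γ hC
      Sc := Sc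
      ιc := ιc
      unif := unif
      isColimit_ιc := hcol
      irreducible := hirr
      unif_cont := hcont
      unif_open := hopen
      unif_surj := hsurj
      unif_iff := hiff
      unif_hol := hhol
      f := f
      piece := piece
      Z := Z
      u := u
      rep := rep
      pts := pts
      rep_spec := hrep
      Z_hol := hZd
      Z_mem := hZm
      f_mk := hfmk
      f_pts := hptsf
      f_rep := hmkrep
      pts_unif := hval
      f_admissible := hadm
      junction := hJunc
      f_injective := hfinj
      f_recip := (hrec Fi τE hcov).1
      cm_recip := (hrec Fi τE hcov).2
      q := q
      q_spec := hQ
      Mρ := Mρ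
      Mρ_kottwitz := fun a v hv b =>
        exists_linear_comm_siegelPeriodMap_charpoly_eq_prod_pow Fr ι₁ (⟨Φ, hΦ.2⟩ : CMType F) hΦ.1 (mOf ι₁ Φ)
          (by simp [mOf]) (by simp [mOf]) (fun φ hφ h h' => by simp [mOf, h, h', hφ]) (fun φ hφ h h' => by simp [mOf, h, h', hφ])
          hδ.1 _ hv (hZm a v hv) (hQ v hv a).1 (fun b t ht => hNρ v hv a b t ht) b
      Mρ_rosati := hR
      ρ₀ := ρ
      Mρ_frame := hfr
      bq_comm_ρ₀ := fun γ b => by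
        rw [MonoidHom.comp_apply, MonoidHom.inl_apply, coe_auxToGspRatV]
        exact (map_intCast_reading_mul_coe_auxRepV_comm Fr ρ hρ ℚ b _).symm
      Z_equivariant := fun a γ hγ v hv v' hv' c hc hγv =>
        exists_siegelLevelGroup_lattice_transport_comm_reading F Fr Φ' ι₁ hg hδ hN hle (fun c => (hrep c).2.2.1) hZm hQ hNρ
          a γ hγ v hv v' hv' c hc hγv }, Fr, rfl, rfl, rfl, hρ⟩


/-! ### §2 The assembly: charts for finitely many frames at ONE common small level, normal in `K` -/

/-- **`stub_EFRAMES` PAID — CHARTS FOR FINITELY MANY FRAMES AT ONE COMMON SMALL LEVEL, NORMAL IN `K`** (the X-leaf letter `RecordEFrames`, cand 9bd9c5d5 :424,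
body TOKEN FOR TOKEN): in every letter context with a signature datum, for a FINITE family of CM types `Φf i ∋ ι₁`, ONE small level `Kc″ ≤ K`, normal in `K`
(`C5.HeckeLE u Kc″ Kc″` for `u ∈ K`), at which EVERY frame `i` has — over every slice field containing a finite Galois `Fᵢ₀(i)` with `τ₀(i) ∣ ι₁` — an auxiliary
Siegel chart `AuxChartGS … Kc″ Fi τE (Φf i)`.  ROAD: open `hsig`; per frame the adapted skew scalar `ξᵢ` (★ `exists_xi_of_sigDatum`); ALL frames cut on ONE
`K`-stable lattice (★ 7b-FAMILY `exists_symplecticFrameV_family_integralAction`, so `K̃_{Frᵢ}(m) = K̃_{Frᵢ′}(m)`); per frame the depth `k₀ᵢ` (§1 `chart_of_frame`);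
`k := sup k₀ᵢ`; ONE saturated small level `Kc″ = K ⊓ bᵢ⁻¹K_{δᵢ}(3(k+1)!)` for every `i`, normal in `K` (★ `exists_smallLevel_saturated_family_of_prod_le`); per frame
the chart at `Kc″` (§1 at `k ≥ k₀ᵢ`).  Sorry-free on the served E-line ED. 5.
[cite: Deligne1971TravauxShimura, Prop. 1.15 p. 132 and Exemple 4.16 p. 150] [cite: RapoportSmithlingZhang2020Diagonal, Remark 3.1 p. 9, Remark 3.2 (ii)(iii) pp. 9–10, §3.2 pp. 11–14]
[cite: Milne2005ShimuraVarieties, Thm. 6.11 p. 74] -/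
theorem eFrames_of_line : ∀ (F : Type) [Field F] [NumberField F] [IsCMField F] [IsGalois ℚ F] (ι₁ : F →+* ℂ)
    (Jstar : Matrix (Fin 2) (Fin 2) F) (_hJ : (Jstar.map (IsCMField.complexConj F))ᵀ = Jstar) (_hJu : IsUnit Jstar)
    (K₀ : C5.OpenCompactSubgroup (GSAdele F Jstar)) (S : RecordSystemGS F Jstar ι₁ K₀) (K : C5.SmallLevel K₀)
    (ιdx : Type) [Finite ιdx] (Φf : ιdx → Set (F →+* ℂ)) (hΦf : ∀ i, IsCMTypeThrough ι₁ (Φf i)) (_hsig : SigDatum F ι₁ Jstar),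
    ∃ (Kc'' : C5.SmallLevel K₀), Kc'' ≤ K ∧ (∀ u ∈ K.1.1, C5.HeckeLE u Kc'' Kc'') ∧
      ∀ i : ιdx, ∃ (Fi₀ : Type) (_ : Field Fi₀) (_ : NumberField Fi₀) (_ : Algebra F Fi₀) (_ : IsGalois F Fi₀) (τ₀ : Fi₀ →+* ℂ),
        τ₀.comp (algebraMap F Fi₀) = ι₁ ∧
        ∀ (Fi : Type) [Field Fi] [NumberField Fi] [Algebra F Fi] [IsGalois F Fi] (τE : Fi →+* ℂ) (j : Fi₀ →ₐ[F] Fi),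
          τE.comp (j : Fi₀ →+* Fi) = τ₀ →
          ∃ (C : AuxChartGS F ι₁ Jstar K₀ S Kc'' Fi τE (Φf i)) (ξ : F) (k : ℕ)
            (Fr : SymplecticFrameV F (RingHom.id F) Jstar ((k : ℚ) • ξ) C.g C.δ), IsChartOfFrame (hΦf i) C ξ k Fr := by
  intro F _ _ _ _ ι₁ Jstar hJ hJu K₀ S K ιdx _ Φf hΦf hsig
  classical
  -- §0 open the signature datum
  obtain ⟨t, hτt, hτt', ⟨T, hT⟩, hpos⟩ := hsig
  -- §1 per frame: the skew scalar adapted to `(Φf i)′ = flip ι₁ (bar (Φf i))` after division by `t` (★ `exists_xi_of_sigDatum`)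
  have hξ := fun i => exists_xi_of_sigDatum (flip ι₁ (bar (⟨Φf i, (hΦf i).2⟩ : CMType F))) hτt hτt'
  choose ξ hξ using hξ
  -- §2 ALL the frames on ONE `K`-stable lattice (★ 7b-FAMILY): integral frames `Frᵢ` of `kᵢ•ψ_{ξᵢ}`, `K × ⊥ ≤ K̃_{Frᵢ}(1)`, readings `ρᵢ`, COMMON levels
  have hbot : IsCompact ((⊥ : Subgroup ↥(torusFinAdelic F)) : Set ↥(torusFinAdelic F)) := by
    rw [Subgroup.coe_bot]
    exact isCompact_singleton
  obtain ⟨k, g, δ, Fr, ρ, hFr, hcommon⟩ :=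
    exists_symplecticFrameV_family_integralAction (RingHom.id F) Jstar ξ (conjTranspose_map_id_of_transpose_map_complexConj hJ) hJu
      (fun i => (hξ i).1) (fun i => (hξ i).2.1) K.1.1 ⊥ K.1.2.2 hbot
  -- §3 per frame: the depth `k₀ᵢ` below which every saturated level carries the chart (§1)
  have hchart := fun i => chart_of_frame F ι₁ Jstar hJ K₀ S K (Φf i) (hΦf i) t hτt hτt' T hT hpos (ξ i) (Fr i) (ρ i)
    (hFr i).2.1 (hFr i).2.2.1 (hFr i).2.2.2.2 ((hξ i).2.2.2 (k i) (hFr i).1)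
  choose k₀ hk₀ using hchart
  -- §4 the common depth `kk := sup k₀ᵢ` and ONE saturated small level for EVERY frame, normal in `K` (★ p849614)
  haveI := Fintype.ofFinite ιdx
  have hN : 3 * ((Finset.univ.sup k₀) + 1).factorial ≠ 0 := by positivity
  obtain ⟨Kc'', hle, hnorm, hsat⟩ := exists_smallLevel_saturated_family_of_prod_le K Fr ⊥ (fun i => (hFr i).2.2.2.1) hcommon hN
  -- §5 per frame: the chart at the common level, PINNED to its frame
  refine ⟨Kc'', hle, hnorm, fun i => ?_⟩
  obtain ⟨Fi₀, _, _, _, _, τ₀, hτ₀, hC⟩ := hk₀ i (Finset.univ.sup k₀) (Finset.le_sup (Finset.mem_univ i)) Kc'' (hsat i)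
  exact ⟨Fi₀, ‹_›, ‹_›, ‹_›, ‹_›, τ₀, hτ₀, fun Fi _ _ _ _ τE j hj => by
    obtain ⟨C, Fr', hpin⟩ := hC Fi τE j hj
    exact ⟨C, ξ i, k i, Fr', hpin⟩⟩

end StubEFramesPaid

end Summit.HodgeConjecture.HodgeConjecture.Cruxes.HLiu418.F0P6aEExports
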